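import Literature.Geometry.DiscreteGeometry.SphericalCapVolume
import Literature.Geometry.DiscreteGeometry.SolidAngleFraction
import Summits.AtomisticToContinuum.Crystallization.Theorems.HullExactificationCascadeZeroDefectDensityAsmFrame
import HarnessLib

/-!
# K2c — containment and transport for the Voronoi ownership census
# (crux `ZeroDefectDensity`, line `birth`, stub `stub_censusContain`, registered signature verbatim;
# route `HullExactificationCascade`, stmt-AtomisticToContinuum-12086, lead c5 wave 2)

Datum: a centre `u`, twelve shell points `p : Fin 12 → ℝ³` with `dist u (p i) ∈ [1 - η, 1 + η]`,
`η = 1/4000`, pairwise distances in `[1 - η, 1 + η]` (soft contact) or `≥ 7/5`; directions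
`dir i = ‖p i - u‖⁻¹ • (p i - u)`.  HYPOTHESIS (stub K2a, certified separately): the model regions
about the pole `e_z`, `SEG = capCone e_z (893/1250) ∩ {x_z < ⟪c_s, x⟫}` with
`c_s = (526205, 0, 304212)/607813`, and `OV = capCone e_z (893/1250) ∩ {x_z < ⟪c₁, x⟫} ∩ {x_z < ⟪c₂, x⟫}`
with `c₁ = (215683, 0, 124356)/248965`, `c₂ = c₁` turned about `e_z` by `(cos, sin) = (4680, 13289)/14089`,
have ball fractions `≤ 16423/10⁶` and `≥ 753/250000`.  CLAIM: (A) for a soft contact pair `(i, j)` the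
region `capCone (dir i) (893/1250) ∩ {⟪dir i, x⟫ < ⟪dir j, x⟫}` has ball fraction `≤ 16423/10⁶`; (B) for
two contacts `j, k` of `i` in contact with each other the double region has ball fraction `≥ 753/250000`.

Proof.  Part 1 (real arithmetic): the contact-cosine WINDOW `[124356/248965, 304212/607813]`
(`ccon_window_num`; true window `[0.4994997, 0.5004998]`), polar NESTING of bisector half-spaces
inside the cap (`ccon_nest`: `tan(θ/2)` is increasing), the AZIMUTH window of a contact pair from the
spherical cosine rule (`ccon_azimuth`: `cos(azimuth) ≥ 0.33221 ≥ 4680/14089`) and the azimuth COVER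
lemma (`ccon_cover`).  Part 2: directions and their window (`ccon_inner_dir`).  Part 3: an
orthonormal basis `B = (e, f, a)` with `e` the unit tangent of a contact direction and `⟪f, w⟫ ≥ 0`
(`ccon_frame`, `ccon_tangent`), model coordinates of `B.repr x`, and TRANSPORT: `B.repr` preserves
volume (`OrthonormalBasis.measurePreserving_measurableEquiv`), so ball fractions compare along
containments through `B.repr` (`ccon_transport`, `ccon_transport'`).  Part 4: `B.repr` carries the
actual region INTO `SEG` (`ccon_seg_le`) and the preimage of `OV` INTO the double region
(`ccon_ov_le`); the registered stub follows.  Mathlib + c4's `…AsmFrame` (`norm_sq_residual`,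
`inner_residual_eq_zero`, `exists_orthonormalBasis_of_orthonormal`); no fact is cited. [folklore]
-/

noncomputable section

namespace Summit.AtomisticToContinuum.Crystallization.Theorems.ZeroDefectDensityBirth

open Real RealInnerProductSpace MeasureTheory Metric Set
open Literature.Geometry.DiscreteGeometry

/-! ### Part 1. Real arithmetic: windows, nesting, azimuth, cover -/

/-- **Contact-cosine window (numerator form).**  For `r₁, r₂, d ∈ [1 - 1/4000, 1 + 1/4000]`:
`(124356/248965)·2r₁r₂ ≤ r₁² + r₂² - d² ≤ (304212/607813)·2r₁r₂` (margins `1.6·10⁻⁵`, `5.7·10⁻⁶`).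
[folklore] -/
theorem ccon_window_num {r₁ r₂ d : ℝ} (h1 : 1 - 1 / 4000 ≤ r₁) (h1' : r₁ ≤ 1 + 1 / 4000)
    (h2 : 1 - 1 / 4000 ≤ r₂) (h2' : r₂ ≤ 1 + 1 / 4000) (h3 : 1 - 1 / 4000 ≤ d)
    (h3' : d ≤ 1 + 1 / 4000) :
    (124356 / 248965 : ℝ) * (2 * (r₁ * r₂)) ≤ r₁ ^ 2 + r₂ ^ 2 - d ^ 2 ∧
      r₁ ^ 2 + r₂ ^ 2 - d ^ 2 ≤ (304212 / 607813 : ℝ) * (2 * (r₁ * r₂)) := by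
  have hd0 : 0 ≤ d := by linarith
  have hd2 : (1 - 1 / 4000 : ℝ) ^ 2 ≤ d ^ 2 := pow_le_pow_left₀ (by norm_num) h3 2
  have hd2' : d ^ 2 ≤ (1 + 1 / 4000 : ℝ) ^ 2 := pow_le_pow_left₀ hd0 h3' 2
  constructor
  · nlinarith [mul_nonneg (sub_nonneg.2 h1) (sub_nonneg.2 h2'),
      mul_nonneg (sub_nonneg.2 h1) (sub_nonneg.2 h2), sub_nonneg.2 h1, sub_nonneg.2 h2,
      sq_nonneg (r₁ - r₂)]
  · nlinarith [mul_nonneg (sub_nonneg.2 h1') (sub_nonneg.2 h2'),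
      mul_nonneg (sub_nonneg.2 h1') (sub_nonneg.2 h1), mul_nonneg (sub_nonneg.2 h2') (sub_nonneg.2 h2)]

/-- **Polar nesting of bisector half-spaces.**  For `(s, co)`, `(s', co')` on the unit circle with
`s, s' > 0` and `co ≤ co'` (the second direction has the SMALLER polar angle), and `Z > 0`:
`(1 - co) Z < s X ⟹ (1 - co') Z < s' X`, because `(1 - co')/s' ≤ (1 - co)/s`
(`tan(θ/2)` is increasing). [folklore] -/
theorem ccon_nest {s co s' co' X Z : ℝ} (hs : 0 < s) (hs' : 0 < s') (h1 : s ^ 2 + co ^ 2 = 1)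
    (h1' : s' ^ 2 + co' ^ 2 = 1) (hle : co ≤ co') (hZ : 0 < Z) (h : (1 - co) * Z < s * X) :
    (1 - co') * Z < s' * X := by
  have hco : co ≤ 1 := by nlinarith
  have hco' : co' ≤ 1 := by nlinarith
  have key : (1 - co') * s ≤ (1 - co) * s' := by
    have ha : 0 ≤ (1 - co') * s := mul_nonneg (by linarith) hs.le
    have hb : 0 ≤ (1 - co) * s' := mul_nonneg (by linarith) hs'.le
    rw [← pow_le_pow_iff_left₀ ha hb two_ne_zero]
    have : ((1 - co) * s') ^ 2 - ((1 - co') * s) ^ 2 = 2 * (1 - co) * (1 - co') * (co' - co) := by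
      have e1 : s ^ 2 = 1 - co ^ 2 := by linarith
      have e2 : s' ^ 2 = 1 - co' ^ 2 := by linarith
      rw [mul_pow, mul_pow, e1, e2]; ring
    nlinarith [mul_nonneg (mul_nonneg (sub_nonneg.2 hco) (sub_nonneg.2 hco')) (sub_nonneg.2 hle)]
  have h2 : (1 - co') * Z * s ≤ (1 - co) * s' * Z := by nlinarith
  have h3 : (1 - co) * s' * Z < s' * (s * X) := by nlinarith
  nlinarith

/-- **Azimuth window of a contact pair, polynomial form.**  If the three direction cosines
`cⱼ = ⟪dⱼ, a⟫`, `cₖ = ⟪dₖ, a⟫`, `g = ⟪dⱼ, dₖ⟫` lie in the window (`g` only needs the lower bound), then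
the tangential inner product `g - cⱼ cₖ = sⱼ sₖ cos(azimuth)` is nonnegative and
`C² (1 - cⱼ²)(1 - cₖ²) ≤ (g - cⱼ cₖ)²` with `C = 4680/14089` (`cos(azimuth) ≥ 0.33221 ≥ C = 0.33217`;
via `sⱼ sₖ ≤ (sⱼ² + sₖ²)/2`). [folklore] -/
theorem ccon_azimuth {cj ck g : ℝ} (hj : (124356 / 248965 : ℝ) ≤ cj) (hj' : cj ≤ 304212 / 607813)
    (hk : (124356 / 248965 : ℝ) ≤ ck) (hk' : ck ≤ 304212 / 607813)
    (hg : (124356 / 248965 : ℝ) ≤ g) :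
    0 ≤ g - cj * ck ∧ (4680 / 14089 : ℝ) ^ 2 * ((1 - cj ^ 2) * (1 - ck ^ 2)) ≤ (g - cj * ck) ^ 2 := by
  have hF : (4680 / 14089 : ℝ) * (1 - (cj ^ 2 + ck ^ 2) / 2) ≤ g - cj * ck := by
    nlinarith [mul_nonneg (sub_nonneg.2 hj') (sub_nonneg.2 hk), sq_nonneg (304212 / 607813 - cj),
      sq_nonneg (304212 / 607813 - ck), sub_nonneg.2 hj', sub_nonneg.2 hk']
  have hpos : 0 ≤ 1 - (cj ^ 2 + ck ^ 2) / 2 := by nlinarith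
  refine ⟨le_trans (mul_nonneg (by norm_num) hpos) hF, ?_⟩
  have hamgm : (1 - cj ^ 2) * (1 - ck ^ 2) ≤ (1 - (cj ^ 2 + ck ^ 2) / 2) ^ 2 := by
    nlinarith [sq_nonneg (cj ^ 2 - ck ^ 2)]
  calc (4680 / 14089 : ℝ) ^ 2 * ((1 - cj ^ 2) * (1 - ck ^ 2))
      ≤ (4680 / 14089 : ℝ) ^ 2 * (1 - (cj ^ 2 + ck ^ 2) / 2) ^ 2 := by gcongr
    _ = ((4680 / 14089 : ℝ) * (1 - (cj ^ 2 + ck ^ 2) / 2)) ^ 2 := by ring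
    _ ≤ (g - cj * ck) ^ 2 := pow_le_pow_left₀ (mul_nonneg (by norm_num) hpos) hF 2

/-- **The azimuth lemma (cover).**  In tangent coordinates `X = ⟪e₀, x⟫`, `Y = ⟪e₁, x⟫`, `Z = ⟪a, x⟫ > 0`:
if `x` is beyond both proxy bisectors — `(1 - co₁) Z < s₁ X` (proxy at azimuth `0`) and
`(1 - co₁) Z < s₁ (C X + S Y)` (proxy at azimuth `g*`, `(C, S) = (4680, 13289)/14089`), with
`(s₁, co₁) = (215683, 124356)/248965` — then `x` is beyond the bisector of any unit direction
`(p, q, co)` with `co₁ ≤ co ≤ 304212/607813`, `p, q ≥ 0` and `cos(azimuth) = p/√(p² + q²) ≥ C`: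
`(1 - co) Z < p X + q Y`.  Mechanism: `(p, q) = α (1, 0) + β (C, S)` with `α, β ≥ 0` and
`(α + β) · (1 - co₁)/s₁ ≥ 1 - co`. [folklore] -/
theorem ccon_cover {X Y Z co p q : ℝ} (hZ : 0 < Z)
    (h1 : (1 - 124356 / 248965 : ℝ) * Z < 215683 / 248965 * X)
    (h2 : (1 - 124356 / 248965 : ℝ) * Z < 215683 / 248965 * (4680 / 14089 * X + 13289 / 14089 * Y))
    (hco : (124356 / 248965 : ℝ) ≤ co) (hco' : co ≤ 304212 / 607813) (hp : 0 ≤ p) (hq : 0 ≤ q)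
    (hpq : p ^ 2 + q ^ 2 + co ^ 2 = 1) (hC : (4680 / 14089 : ℝ) ^ 2 * (p ^ 2 + q ^ 2) ≤ p ^ 2) :
    (1 - co) * Z < p * X + q * Y := by
  have hX : (124609 / 215683 : ℝ) * Z < X := by nlinarith
  have hXY : (124609 / 215683 : ℝ) * Z < 4680 / 14089 * X + 13289 / 14089 * Y := by nlinarith
  set α : ℝ := p - q * (4680 / 13289) with hα_def
  set β : ℝ := q * (14089 / 13289) with hβ_def
  have hβ : 0 ≤ β := by rw [hβ_def]; positivity
  have hα : 0 ≤ α := by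
    rw [hα_def, sub_nonneg]
    have h' : (4680 / 14089 * q) ^ 2 ≤ (13289 / 14089 * p) ^ 2 := by nlinarith
    have h'' := (pow_le_pow_iff_left₀ (by positivity) (by positivity) two_ne_zero).1 h'
    nlinarith
  have hid : p * X + q * Y = α * X + β * (4680 / 14089 * X + 13289 / 14089 * Y) := by
    rw [hα_def, hβ_def]; ring
  have hsum_sq : p ^ 2 + q ^ 2 ≤ (α + β) ^ 2 := by
    rw [hα_def, hβ_def]; nlinarith [mul_nonneg hα hq]
  have hab : 0 ≤ α + β := add_nonneg hα hβ
  have hco1 : co < 1 := by linarith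
  have hkey : (1 - co) ≤ (α + β) * (124609 / 215683) := by
    have hb : 0 ≤ (α + β) * (124609 / 215683) := by positivity
    rw [← pow_le_pow_iff_left₀ (by linarith) hb two_ne_zero]
    have : (1 - co) ^ 2 ≤ (p ^ 2 + q ^ 2) * (124609 / 215683) ^ 2 := by
      have e : p ^ 2 + q ^ 2 = (1 - co) * (1 + co) := by nlinarith
      rw [e]
      nlinarith [mul_nonneg (sub_nonneg.2 hco) (sub_nonneg.2 hco1.le)]
    nlinarith
  have hpos : 0 < α + β := by
    rcases hab.lt_or_eq with h | h
    · exact h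
    · exfalso
      have : p ^ 2 + q ^ 2 ≤ 0 := by rw [← h] at hsum_sq; simpa using hsum_sq
      nlinarith
  rw [hid]
  rcases hα.lt_or_eq with hαp | hα0
  · have e1 : α * ((124609 / 215683 : ℝ) * Z) < α * X := mul_lt_mul_of_pos_left hX hαp
    have e2 : β * ((124609 / 215683 : ℝ) * Z) ≤ β * (4680 / 14089 * X + 13289 / 14089 * Y) :=
      mul_le_mul_of_nonneg_left hXY.le hβ
    nlinarith
  · have hβp : 0 < β := by rw [← hα0] at hpos; simpa using hpos
    have e2 : β * ((124609 / 215683 : ℝ) * Z) < β * (4680 / 14089 * X + 13289 / 14089 * Y) :=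
      mul_lt_mul_of_pos_left hXY hβp
    rw [← hα0]
    nlinarith

/-! ### Part 2. Directions and their cosine window -/

/-- **Contact-cosine window for directions.**  If `‖x‖, ‖y‖, ‖x - y‖ ∈ [1 - 1/4000, 1 + 1/4000]` then
`⟪x/‖x‖, y/‖y‖⟫ = (‖x‖² + ‖y‖² - ‖x - y‖²)/(2‖x‖‖y‖) ∈ [124356/248965, 304212/607813]`. [folklore] -/
theorem ccon_inner_dir {x y : EuclideanSpace ℝ (Fin 3)} (hx : 1 - 1 / 4000 ≤ ‖x‖)
    (hx' : ‖x‖ ≤ 1 + 1 / 4000) (hy : 1 - 1 / 4000 ≤ ‖y‖) (hy' : ‖y‖ ≤ 1 + 1 / 4000)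
    (hxy : 1 - 1 / 4000 ≤ ‖x - y‖) (hxy' : ‖x - y‖ ≤ 1 + 1 / 4000) :
    (124356 / 248965 : ℝ) ≤ ⟪‖x‖⁻¹ • x, ‖y‖⁻¹ • y⟫ ∧ ⟪‖x‖⁻¹ • x, ‖y‖⁻¹ • y⟫ ≤ 304212 / 607813 := by
  have hx0 : 0 < ‖x‖ := by linarith
  have hy0 : 0 < ‖y‖ := by linarith
  have hinner : ⟪x, y⟫ = (‖x‖ ^ 2 + ‖y‖ ^ 2 - ‖x - y‖ ^ 2) / 2 := by
    rw [@norm_sub_sq_real]; ring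
  have h := ccon_window_num hx hx' hy hy' hxy hxy'
  have hq : ⟪‖x‖⁻¹ • x, ‖y‖⁻¹ • y⟫ = (‖x‖ ^ 2 + ‖y‖ ^ 2 - ‖x - y‖ ^ 2) / (2 * (‖x‖ * ‖y‖)) := by
    rw [real_inner_smul_left, real_inner_smul_right, hinner]
    field_simp
  rw [hq, le_div_iff₀ (by positivity), div_le_iff₀ (by positivity)]
  exact h

/-- A vector of norm `≥ 1 - 1/4000` normalises to a unit vector. [folklore] -/
theorem ccon_norm_dir {x : EuclideanSpace ℝ (Fin 3)} (hx : 1 - 1 / 4000 ≤ ‖x‖) : ‖‖x‖⁻¹ • x‖ = 1 := by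
  have hx0 : 0 < ‖x‖ := by linarith
  rw [norm_smul, norm_inv, norm_norm, inv_mul_cancel₀ hx0.ne']

/-! ### Part 3. Frames, model coordinates, transport of ball fractions -/

/-- **Frame.**  An orthonormal pair `(e, a)` of `ℝ³` extends to an orthonormal basis `B` with
`B 0 = e`, `B 2 = a`, and the sign of `B 1` chosen so that `⟪B 1, w⟫ ≥ 0`. [folklore] -/
theorem ccon_frame {a e : EuclideanSpace ℝ (Fin 3)} (ha : ‖a‖ = 1) (he : ‖e‖ = 1) (hea : ⟪e, a⟫ = 0)
    (w : EuclideanSpace ℝ (Fin 3)) :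
    ∃ B : OrthonormalBasis (Fin 3) ℝ (EuclideanSpace ℝ (Fin 3)), B 0 = e ∧ B 2 = a ∧ 0 ≤ ⟪B 1, w⟫ := by
  have hae : ⟪a, e⟫ = 0 := by rw [real_inner_comm]; exact hea
  have hv : Orthonormal ℝ (({0, 2} : Set (Fin 3)).restrict ![e, e, a]) := by
    rw [orthonormal_iff_ite]
    rintro ⟨i, hi⟩ ⟨j, hj⟩
    simp only [Set.mem_insert_iff, Set.mem_singleton_iff] at hi hj
    rcases hi with rfl | rfl <;> rcases hj with rfl | rfl <;>
      simp [Set.restrict_apply, hea, hae, ha, he]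
  obtain ⟨B₀, hB₀⟩ := Orthonormal.exists_orthonormalBasis_extension_of_card_eq
    (𝕜 := ℝ) (E := EuclideanSpace ℝ (Fin 3)) (by simp) hv
  have h0 : B₀ 0 = e := by simpa using hB₀ 0 (by simp)
  have h2 : B₀ 2 = a := by simpa using hB₀ 2 (by simp)
  by_cases hs : 0 ≤ ⟪B₀ 1, w⟫
  · exact ⟨B₀, h0, h2, hs⟩
  · have hon : Orthonormal ℝ ![e, -B₀ 1, a] := by
      refine B₀.orthonormal.orthonormal_of_forall_eq_or_eq_neg ?_
      intro i
      fin_cases i <;> simp [h0, h2]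
    obtain ⟨B, hB⟩ := exists_orthonormalBasis_of_orthonormal hon
    refine ⟨B, by simp [hB], by simp [hB], ?_⟩
    rw [hB]
    simp only [Matrix.cons_val_one, Matrix.cons_val_zero, inner_neg_left]
    linarith

/-- Membership in the cut-off cone `capCone a c = {c‖x‖ < ⟪a, x⟫} ∩ B(0,1)`. [folklore] -/
theorem ccon_mem_capCone_iff (a : EuclideanSpace ℝ (Fin 3)) (c : ℝ) (x : EuclideanSpace ℝ (Fin 3)) :
    x ∈ capCone a c ↔ c * ‖x‖ < ⟪a, x⟫ ∧ ‖x‖ < 1 := by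
  simp [capCone]

/-- Model coordinates: the pole component of `B.repr x` is `⟪B 2, x⟫`. [folklore] -/
theorem ccon_inner_single_repr (B : OrthonormalBasis (Fin 3) ℝ (EuclideanSpace ℝ (Fin 3)))
    (x : EuclideanSpace ℝ (Fin 3)) :
    ⟪EuclideanSpace.single (2 : Fin 3) (1 : ℝ), B.repr x⟫ = ⟪B 2, x⟫ := by
  rw [EuclideanSpace.inner_single_left, B.repr_apply_apply]; simp

/-- Model coordinates: `⟪(α, β, γ), B.repr x⟫ = α⟪B 0, x⟫ + β⟪B 1, x⟫ + γ⟪B 2, x⟫`. [folklore] -/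
theorem ccon_inner_toLp_repr (B : OrthonormalBasis (Fin 3) ℝ (EuclideanSpace ℝ (Fin 3))) (α β γ : ℝ)
    (x : EuclideanSpace ℝ (Fin 3)) :
    ⟪(WithLp.toLp 2 ![α, β, γ] : EuclideanSpace ℝ (Fin 3)), B.repr x⟫ =
      α * ⟪B 0, x⟫ + β * ⟪B 1, x⟫ + γ * ⟪B 2, x⟫ := by
  rw [← B.repr_apply_apply, ← B.repr_apply_apply, ← B.repr_apply_apply]
  simp [PiLp.inner_apply, Fin.sum_univ_three, mul_comm]

/-- Ball fractions about `0` are monotone in the volume of the trace on `B(0,1)`. [folklore] -/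
theorem ccon_ballFraction_le_of_volume_le {S T : Set (EuclideanSpace ℝ (Fin 3))}
    (h : volume (ball (0 : EuclideanSpace ℝ (Fin 3)) 1 ∩ S) ≤ volume (ball (0 : EuclideanSpace ℝ (Fin 3)) 1 ∩ T)) :
    ballFraction (0 : EuclideanSpace ℝ (Fin 3)) S ≤ ballFraction (0 : EuclideanSpace ℝ (Fin 3)) T := by
  unfold ballFraction
  refine div_le_div_of_nonneg_right ?_ ENNReal.toReal_nonneg
  exact ENNReal.toReal_mono
    (measure_lt_top_of_subset inter_subset_left measure_ball_lt_top.ne).ne h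

/-- **Transport (upper bounds).**  `B.repr` is volume preserving
(`OrthonormalBasis.measurePreserving_measurableEquiv`), so if `B(0,1) ∩ S` is carried into
`B(0,1) ∩ T` then `ballFraction 0 S ≤ ballFraction 0 T`. [folklore] -/
theorem ccon_transport (B : OrthonormalBasis (Fin 3) ℝ (EuclideanSpace ℝ (Fin 3)))
    {S T : Set (EuclideanSpace ℝ (Fin 3))}
    (h : ball (0 : EuclideanSpace ℝ (Fin 3)) 1 ∩ S ⊆ B.repr ⁻¹' (ball (0 : EuclideanSpace ℝ (Fin 3)) 1 ∩ T)) :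
    ballFraction (0 : EuclideanSpace ℝ (Fin 3)) S ≤ ballFraction (0 : EuclideanSpace ℝ (Fin 3)) T := by
  refine ccon_ballFraction_le_of_volume_le ?_
  rw [← B.measurePreserving_measurableEquiv.measure_preimage_equiv (ball (0 : EuclideanSpace ℝ (Fin 3)) 1 ∩ T)]
  exact measure_mono h

/-- **Transport (lower bounds).**  If the `B.repr`-preimage of `B(0,1) ∩ S` lies in `B(0,1) ∩ T` then
`ballFraction 0 S ≤ ballFraction 0 T`. [folklore] -/
theorem ccon_transport' (B : OrthonormalBasis (Fin 3) ℝ (EuclideanSpace ℝ (Fin 3)))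
    {S T : Set (EuclideanSpace ℝ (Fin 3))}
    (h : B.repr ⁻¹' (ball (0 : EuclideanSpace ℝ (Fin 3)) 1 ∩ S) ⊆ ball (0 : EuclideanSpace ℝ (Fin 3)) 1 ∩ T) :
    ballFraction (0 : EuclideanSpace ℝ (Fin 3)) S ≤ ballFraction (0 : EuclideanSpace ℝ (Fin 3)) T := by
  refine ccon_ballFraction_le_of_volume_le ?_
  rw [← B.measurePreserving_measurableEquiv.measure_preimage_equiv (ball (0 : EuclideanSpace ℝ (Fin 3)) 1 ∩ S)]
  exact measure_mono h

/-- **Tangent decomposition of a contact direction.**  For unit `a`, `d` with `⟪d, a⟫` in the window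
there are a unit `e ⊥ a` and `s > 0` with `s² + ⟪d, a⟫² = 1` and `⟪d, y⟫ = ⟪d, a⟫⟪a, y⟫ + s⟪e, y⟫`
for all `y` (`e = unit(d - ⟪d, a⟫ a)`, `s = ‖d - ⟪d, a⟫ a‖ = sin(polar angle)`). [folklore] -/
theorem ccon_tangent {a d : EuclideanSpace ℝ (Fin 3)} (ha : ‖a‖ = 1) (hd : ‖d‖ = 1)
    (h1 : (124356 / 248965 : ℝ) ≤ ⟪d, a⟫) (h2 : ⟪d, a⟫ ≤ 304212 / 607813) :
    ∃ e : EuclideanSpace ℝ (Fin 3), ∃ s : ℝ, ‖e‖ = 1 ∧ ⟪e, a⟫ = 0 ∧ 0 < s ∧ s ^ 2 + ⟪d, a⟫ ^ 2 = 1 ∧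
      ∀ y : EuclideanSpace ℝ (Fin 3), ⟪d, y⟫ = ⟪d, a⟫ * ⟪a, y⟫ + s * ⟪e, y⟫ := by
  set W : EuclideanSpace ℝ (Fin 3) := d - ⟪d, a⟫ • a with hW
  have hWsq : ‖W‖ ^ 2 = 1 - ⟪d, a⟫ ^ 2 := by
    rw [hW, norm_sq_residual ha, hd]; ring
  have hspos : 0 < ‖W‖ := by
    rcases (norm_nonneg W).eq_or_lt with h0 | h0
    · rw [← h0] at hWsq; nlinarith
    · exact h0
  refine ⟨‖W‖⁻¹ • W, ‖W‖, ?_, ?_, hspos, by rw [hWsq]; ring, fun y => ?_⟩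
  · rw [norm_smul, norm_inv, norm_norm, inv_mul_cancel₀ hspos.ne']
  · rw [real_inner_smul_left, hW, inner_residual_eq_zero ha, mul_zero]
  · rw [real_inner_smul_left, ← mul_assoc, mul_inv_cancel₀ hspos.ne', one_mul, hW,
      inner_sub_left, real_inner_smul_left]
    ring

/-! ### Part 4. The two containments and the registered stub -/

/-- **(A), frame form.**  For unit `a`, `d` with `⟪d, a⟫ ∈ [124356/248965, 304212/607813]` the region
`capCone a (893/1250) ∩ {⟪a, x⟫ < ⟪d, x⟫}` has ball fraction at most that of the model region `SEG`:
its image under `B.repr` (`B = (e, ·, a)`, `d = ⟪d,a⟫ a + s e`) lies in `SEG` by polar nesting. [folklore] -/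
theorem ccon_seg_le {a d : EuclideanSpace ℝ (Fin 3)} (ha : ‖a‖ = 1) (hd : ‖d‖ = 1)
    (h1 : (124356 / 248965 : ℝ) ≤ ⟪d, a⟫) (h2 : ⟪d, a⟫ ≤ 304212 / 607813) :
    ballFraction (0 : EuclideanSpace ℝ (Fin 3))
        (capCone a (893 / 1250) ∩ {x : EuclideanSpace ℝ (Fin 3) | ⟪a, x⟫ < ⟪d, x⟫}) ≤
      ballFraction (0 : EuclideanSpace ℝ (Fin 3)) (capCone (EuclideanSpace.single (2 : Fin 3) (1 : ℝ)) (893 / 1250) ∩ {x : EuclideanSpace ℝ (Fin 3) | inner ℝ (EuclideanSpace.single (2 : Fin 3) (1 : ℝ)) x < inner ℝ (WithLp.toLp 2 ![(526205 / 607813 : ℝ), 0, 304212 / 607813] : EuclideanSpace ℝ (Fin 3)) x}) := by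
  obtain ⟨e, s, he, hea, hs, hs1, hdec⟩ := ccon_tangent ha hd h1 h2
  obtain ⟨B, hB0, hB2, -⟩ := ccon_frame ha he hea 0
  refine ccon_transport B ?_
  rintro x ⟨-, hxc, hxl⟩
  rw [ccon_mem_capCone_iff] at hxc
  rw [mem_setOf_eq, hdec x] at hxl
  have hZ : 0 < ⟪a, x⟫ := lt_of_le_of_lt (by positivity) hxc.1
  have hl : (1 - ⟪d, a⟫) * ⟪a, x⟫ < s * ⟪e, x⟫ := by linarith
  have hn := ccon_nest (s' := 526205 / 607813) (co' := 304212 / 607813) hs (by norm_num) hs1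
    (by norm_num) h2 hZ hl
  simp only [mem_preimage, mem_inter_iff, mem_ball_zero_iff, ccon_mem_capCone_iff, mem_setOf_eq,
    LinearIsometryEquiv.norm_map, ccon_inner_single_repr, ccon_inner_toLp_repr, hB0, hB2]
  refine ⟨hxc.2, ⟨hxc.1, hxc.2⟩, ?_⟩
  linarith

/-- **(B), frame form.**  For unit `a`, `dj`, `dk` with `⟪dj, a⟫`, `⟪dk, a⟫` in the window and
`⟪dj, dk⟫ ≥ 124356/248965`, the double region
`capCone a (893/1250) ∩ {⟪a, x⟫ < ⟪dj, x⟫} ∩ {⟪a, x⟫ < ⟪dk, x⟫}` has ball fraction at least that of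
the model region `OV`: the `B.repr`-preimage of `OV` (`B = (e, f, a)`, `e` the unit tangent of `dj`,
`⟪f, dk⟫ ≥ 0`) lies in it by reverse polar nesting and the azimuth lemma. [folklore] -/
theorem ccon_ov_le {a dj dk : EuclideanSpace ℝ (Fin 3)} (ha : ‖a‖ = 1) (hdj : ‖dj‖ = 1)
    (hdk : ‖dk‖ = 1) (hj1 : (124356 / 248965 : ℝ) ≤ ⟪dj, a⟫) (hj2 : ⟪dj, a⟫ ≤ 304212 / 607813)
    (hk1 : (124356 / 248965 : ℝ) ≤ ⟪dk, a⟫) (hk2 : ⟪dk, a⟫ ≤ 304212 / 607813)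
    (hg : (124356 / 248965 : ℝ) ≤ ⟪dj, dk⟫) :
    ballFraction (0 : EuclideanSpace ℝ (Fin 3)) (capCone (EuclideanSpace.single (2 : Fin 3) (1 : ℝ)) (893 / 1250) ∩ {x : EuclideanSpace ℝ (Fin 3) | inner ℝ (EuclideanSpace.single (2 : Fin 3) (1 : ℝ)) x < inner ℝ (WithLp.toLp 2 ![(215683 / 248965 : ℝ), 0, 124356 / 248965] : EuclideanSpace ℝ (Fin 3)) x} ∩ {x : EuclideanSpace ℝ (Fin 3) | inner ℝ (EuclideanSpace.single (2 : Fin 3) (1 : ℝ)) x < inner ℝ (WithLp.toLp 2 ![(215683 / 248965 * (4680 / 14089) : ℝ), 215683 / 248965 * (13289 / 14089), 124356 / 248965] : EuclideanSpace ℝ (Fin 3)) x}) ≤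
      ballFraction (0 : EuclideanSpace ℝ (Fin 3))
        (capCone a (893 / 1250) ∩ {x : EuclideanSpace ℝ (Fin 3) | ⟪a, x⟫ < ⟪dj, x⟫} ∩
          {x : EuclideanSpace ℝ (Fin 3) | ⟪a, x⟫ < ⟪dk, x⟫}) := by
  obtain ⟨e, s, he, hea, hs, hs1, hdec⟩ := ccon_tangent ha hdj hj1 hj2
  obtain ⟨B, hB0, hB2, hq⟩ := ccon_frame ha he hea dk
  -- coordinates of `dk` in the frame `B = (e, B 1, a)`
  have hck : ⟪B 2, dk⟫ = ⟪dk, a⟫ := by rw [hB2, real_inner_comm]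
  have hpars : ⟪B 0, dk⟫ ^ 2 + ⟪B 1, dk⟫ ^ 2 + ⟪dk, a⟫ ^ 2 = 1 := by
    have h := B.sum_sq_inner_right dk
    rw [Fin.sum_univ_three, hck, hdk, one_pow] at h
    exact h
  have hppe : s * ⟪B 0, dk⟫ = ⟪dj, dk⟫ - ⟪dj, a⟫ * ⟪dk, a⟫ := by
    rw [hB0, hdec dk, real_inner_comm dk a]; ring
  obtain ⟨haz0, haz⟩ := ccon_azimuth hj1 hj2 hk1 hk2 hg
  have hp0 : 0 ≤ ⟪B 0, dk⟫ := by
    rw [← hppe] at haz0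
    exact nonneg_of_mul_nonneg_right haz0 hs
  have hC : (4680 / 14089 : ℝ) ^ 2 * (⟪B 0, dk⟫ ^ 2 + ⟪B 1, dk⟫ ^ 2) ≤ ⟪B 0, dk⟫ ^ 2 := by
    rw [← hppe] at haz
    have e1 : 1 - ⟪dj, a⟫ ^ 2 = s ^ 2 := by linarith
    have e2 : 1 - ⟪dk, a⟫ ^ 2 = ⟪B 0, dk⟫ ^ 2 + ⟪B 1, dk⟫ ^ 2 := by linarith
    rw [e1, e2] at haz
    have hs2 : 0 < s ^ 2 := by positivity
    nlinarith
  have hdk_dec : ∀ y : EuclideanSpace ℝ (Fin 3),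
      ⟪dk, y⟫ = ⟪B 0, dk⟫ * ⟪e, y⟫ + ⟪B 1, dk⟫ * ⟪B 1, y⟫ + ⟪dk, a⟫ * ⟪a, y⟫ := by
    intro y
    rw [← B.sum_inner_mul_inner dk y, Fin.sum_univ_three, ← hck, real_inner_comm (B 0) dk,
      real_inner_comm (B 1) dk, real_inner_comm (B 2) dk, hB0, hB2]
  refine ccon_transport' B ?_
  intro x hx
  simp only [mem_preimage, mem_inter_iff, mem_ball_zero_iff, ccon_mem_capCone_iff, mem_setOf_eq,
    LinearIsometryEquiv.norm_map, ccon_inner_single_repr, ccon_inner_toLp_repr, hB0, hB2] at hx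
  obtain ⟨hxb, ⟨⟨hxc, -⟩, hx1⟩, hx2⟩ := hx
  have hZ : 0 < ⟪a, x⟫ := lt_of_le_of_lt (by positivity) hxc
  have h1' : (1 - 124356 / 248965 : ℝ) * ⟪a, x⟫ < 215683 / 248965 * ⟪e, x⟫ := by linarith
  have h2' : (1 - 124356 / 248965 : ℝ) * ⟪a, x⟫ <
      215683 / 248965 * (4680 / 14089 * ⟪e, x⟫ + 13289 / 14089 * ⟪B 1, x⟫) := by linarith
  refine ⟨mem_ball_zero_iff.2 hxb, ⟨(ccon_mem_capCone_iff _ _ _).2 ⟨hxc, hxb⟩, ?_⟩, ?_⟩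
  · rw [mem_setOf_eq, hdec x]
    have hn := ccon_nest (s := 215683 / 248965) (co := 124356 / 248965) (by norm_num) hs
      (by norm_num) hs1 hj1 hZ h1'
    linarith
  · rw [mem_setOf_eq, hdk_dec x]
    have hc := ccon_cover hZ h1' h2' hk1 hk2 hp0 hq hpars hC
    linarith

/-- **STUB K2c of the birth line — containment and transport** (registered signature verbatim).
Given the two certified model ball fractions (K2a, the hypothesis), for every `1/4000`-soft gapped
twelve-shell `(u, p)`: (A) for a soft contact pair `(i, j)` the region
`capCone (dir i) (893/1250) ∩ {⟪dir i, x⟫ < ⟪dir j, x⟫}` has ball fraction `≤ 16423/10⁶`, and (B) for two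
contacts `j, k` of `i` in contact with each other the double region has ball fraction `≥ 753/250000`
(`dir i = ‖p i - u‖⁻¹ • (p i - u)`).  Proof: the contact cosines lie in the window
(`ccon_inner_dir`), then `ccon_seg_le` / `ccon_ov_le`. [folklore] -/
theorem stub_censusContain : (Literature.Geometry.DiscreteGeometry.ballFraction (0 : EuclideanSpace ℝ (Fin 3)) (Literature.Geometry.DiscreteGeometry.capCone (EuclideanSpace.single (2 : Fin 3) (1 : ℝ)) (893 / 1250) ∩ {x : EuclideanSpace ℝ (Fin 3) | inner ℝ (EuclideanSpace.single (2 : Fin 3) (1 : ℝ)) x < inner ℝ (WithLp.toLp 2 ![(526205 / 607813 : ℝ), 0, 304212 / 607813] : EuclideanSpace ℝ (Fin 3)) x}) ≤ 16423 / 1000000 ∧ (753 / 250000 : ℝ) ≤ Literature.Geometry.DiscreteGeometry.ballFraction (0 : EuclideanSpace ℝ (Fin 3)) (Literature.Geometry.DiscreteGeometry.capCone (EuclideanSpace.single (2 : Fin 3) (1 : ℝ)) (893 / 1250) ∩ {x : EuclideanSpace ℝ (Fin 3) | inner ℝ (EuclideanSpace.single (2 : Fin 3) (1 : ℝ)) x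 < inner ℝ (WithLp.toLp 2 ![(215683 / 248965 : ℝ), 0, 124356 / 248965] : EuclideanSpace ℝ (Fin 3)) x} ∩ {x : EuclideanSpace ℝ (Fin 3) | inner ℝ (EuclideanSpace.single (2 : Fin 3) (1 : ℝ)) x < inner ℝ (WithLp.toLp 2 ![(215683 / 248965 * (4680 / 14089) : ℝ), 215683 / 248965 * (13289 / 14089), 124356 / 248965] : EuclideanSpace ℝ (Fin 3)) x})) → ∀ (u : EuclideanSpace ℝ (Fin 3)) (p : Fin 12 → EuclideanSpace ℝ (Fin 3)), (∀ i : Fin 12, 1 - 1 / 4000 ≤ dist u (p i) ∧ dist u (p i) ≤ 1 + 1 / 4000) → (∀ i j : Fin 12, i ≠ j → 1 - 1 / 4000 ≤ dist (p i) (p j) ∧ (dist (p i) (p j) ≤ 1 + 1 / 4000 ∨ 7 / 5 ≤ dist (p i) (p j))) → (∀ i j : Fin 12, i ≠ j → dist (p i) (p j) ≤ 1 + 1 / 4000 → Literature.Geometry.DiscreteGeometry.ballFraction (0 : EuclideanSpace ℝ (Fin 3)) (Literature.Geometry.DiscreteGeometry.capCone (‖p i - u‖⁻¹ • (p i - u))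 (893 / 1250) ∩ {x : EuclideanSpace ℝ (Fin 3) | inner ℝ (‖p i - u‖⁻¹ • (p i - u)) x < inner ℝ (‖p j - u‖⁻¹ • (p j - u)) x}) ≤ 16423 / 1000000) ∧ (∀ i j k : Fin 12, i ≠ j → i ≠ k → j ≠ k → dist (p i) (p j) ≤ 1 + 1 / 4000 → dist (p i) (p k) ≤ 1 + 1 / 4000 → dist (p j) (p k) ≤ 1 + 1 / 4000 → (753 / 250000 : ℝ) ≤ Literature.Geometry.DiscreteGeometry.ballFraction (0 : EuclideanSpace ℝ (Fin 3)) (Literature.Geometry.DiscreteGeometry.capCone (‖p i - u‖⁻¹ • (p i - u)) (893 / 1250) ∩ {x : EuclideanSpace ℝ (Fin 3) | inner ℝ (‖p i - u‖⁻¹ • (p i - u)) x < inner ℝ (‖p j - u‖⁻¹ • (p j - u)) x} ∩ {x : EuclideanSpace ℝ (Fin 3) | inner ℝ (‖p i - u‖⁻¹ • (p i - u)) x < inner ℝ (‖p k - u‖⁻¹ • (p k - u)) x})) := by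
  intro hcert u p hR hP
  have hr : ∀ i : Fin 12, 1 - 1 / 4000 ≤ ‖p i - u‖ ∧ ‖p i - u‖ ≤ 1 + 1 / 4000 := fun i => by
    rw [← dist_eq_norm, dist_comm]; exact hR i
  have hpd : ∀ i j : Fin 12, ‖(p i - u) - (p j - u)‖ = dist (p i) (p j) := fun i j => by
    rw [sub_sub_sub_cancel_right, dist_eq_norm]
  -- the contact-cosine window for a soft contact pair
  have hwin : ∀ i j : Fin 12, i ≠ j → dist (p i) (p j) ≤ 1 + 1 / 4000 →
      (124356 / 248965 : ℝ) ≤ ⟪‖p i - u‖⁻¹ • (p i - u), ‖p j - u‖⁻¹ • (p j - u)⟫ ∧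
        ⟪‖p i - u‖⁻¹ • (p i - u), ‖p j - u‖⁻¹ • (p j - u)⟫ ≤ 304212 / 607813 := by
    intro i j hij hd
    have hlo := (hP i j hij).1
    rw [← hpd i j] at hlo hd
    exact ccon_inner_dir (hr i).1 (hr i).2 (hr j).1 (hr j).2 hlo hd
  refine ⟨fun i j hij hd => ?_, fun i j k hij hik hjk hdij hdik hdjk => ?_⟩
  · have hw := hwin j i (Ne.symm hij) (by rw [dist_comm]; exact hd)
    exact le_trans (ccon_seg_le (ccon_norm_dir (hr i).1) (ccon_norm_dir (hr j).1) hw.1 hw.2) hcert.1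
  · have hwj := hwin j i (Ne.symm hij) (by rw [dist_comm]; exact hdij)
    have hwk := hwin k i (Ne.symm hik) (by rw [dist_comm]; exact hdik)
    have hwjk := hwin j k hjk hdjk
    exact le_trans hcert.2 (ccon_ov_le (ccon_norm_dir (hr i).1) (ccon_norm_dir (hr j).1)
      (ccon_norm_dir (hr k).1) hwj.1 hwj.2 hwk.1 hwk.2 hwjk.1)

end Summit.AtomisticToContinuum.Crystallization.Theorems.ZeroDefectDensityBirth

end
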